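import Literature.NumberTheory.Automorphic.ParallelWeightAdelicCoefficients
import Mathlib.Topology.Algebra.Module.FiniteDimension
import HarnessLib

/-!
# The continuous extensions `φ_τ : K_{v(τ)} → ℚ̄_p` are integral on `𝒪_{v(τ)}`, and all land in one
# finite extension `E/ℚ_p`; the coefficient ring `𝒪_E = {x ∈ E : |x| ≤ 1}`

Topic `NumberTheory/Automorphic`; namespace `Literature.NumberTheory.Automorphic.ParallelWeight`
(that of the place data `padicPlace`, `padicPlaceHom` of `ParallelWeightAdelicCoefficients`).
Definitions with bodies and theorems; no named fact, no instance, no `sorry`.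

For a number field `K`, a prime `p` and an embedding `τ : K → ℚ̄_p` with its place `v(τ) ∣ p` and
continuous extension `φ_τ : K_{v(τ)} → ℚ̄_p` (Neukirch II §8):

* `valued_padicPlaceHom_le_one` — **`φ_τ` maps the valuation ring `𝒪_{v(τ)}` into `ℤ̄_p`**
  (`|y|_{v(τ)} ≤ 1 ⇒ |φ_τ y| ≤ 1`): on `K` this is `|τ x| ≤ 1 ↔ v(x) ≥ 0` (the tree's
  `valued_le_one_iff_valuation_le_one`, Neukirch II (8.1)), and `K ∩ 𝒪_v` is dense in the open
  subring `𝒪_v` while `{|φ_τ ·| ≤ 1}` is closed;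
* `padicPlaceHom_mem_of_forall_mem` — `φ_τ(K_{v(τ)})` lies in any CLOSED subfield containing `τ(K)`
  (density of `K` in `K_v`), hence `exists_intermediateField_forall_padicPlaceHom_mem` — **there is a
  finite extension `E/ℚ_p` inside `ℚ̄_p` containing every `φ_τ(K_{v(τ)})`** (the compositum of the
  `ℚ_p(τ θ)`, `θ` a primitive element; finite-dimensional subspaces of `ℚ̄_p` are closed):
  Neukirch II §8, p. 161 ("the finite complete extension `τL · K_v` of `K_v`");
* `coeffField K p`, `coeffRing K p` — a CHOICE of such an `E` and its closed unit ball
  `𝒪_E = {x ∈ E : |x| ≤ 1}`, a subring of `ℚ̄_p` containing `p`, with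
  `padicPlaceHom_mem_coeffRing : |y| ≤ 1 → φ_τ y ∈ 𝒪_E` — the hypothesis `h𝒪` under which the
  lattices `M_λ ⊆ E_λ(ℚ̄_p)` over `𝒪` are stable under `GL_n(𝒪̂_K)` (`TameLevelCoeffLattice`).

This supplies "a finite extension `E` of `ℚ_p` with ring of integers `𝒪` over which `ξ` and the
lattice `M_ξ` are defined" implicit in [Scholze2015, §V.4] (where `M_ξ` is a `ℤ̄_p`-module;
working over `𝒪_E` keeps the coefficient ring Noetherian).

## References

* J. Neukirch, *Algebraic Number Theory* (1999), Ch. II §8 (pp. 160–161), (8.1). [NeukirchANT1999]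
* P. Scholze, *On torsion in the cohomology of locally symmetric varieties*, Ann. of Math. 182
  (2015), §V.4 (arXiv:1306.2070, pp. 66–67). [Scholze2015]
-/

noncomputable section

open scoped NumberField
open IsDedekindDomain

namespace Literature.NumberTheory.Automorphic.ParallelWeight

variable (K : Type) [Field K] [NumberField K] (p : ℕ) [Fact p.Prime]

/-! ### `φ_τ` is integral on `𝒪_{v(τ)}` -/

/-- On `K`, `|τ x| ≤ 1 ↔ v(τ)(x) ≥ 0` (the tree's `valued_le_one_iff_valuation_le_one` for the
place cut out by `τ`). [cite: NeukirchANT1999, Ch. II (8.1)] -/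
theorem valued_le_one_iff (τ : K →+* PadicAlgCl p) (x : K) :
    Valued.v (τ x) ≤ 1 ↔ (padicPlace K p τ).valuation K x ≤ 1 :=
  Literature.NumberTheory.EllipticCurves.ModularForms.DeligneSerre1974.valued_le_one_iff_valuation_le_one
    τ (padicPlace K p τ) (natCast_mem_padicPlace K p τ)
    (Literature.NumberTheory.EllipticCurves.valued_ringHom_ringOfIntegers_le_one τ)
    (valued_lt_one_iff_mem_padicPlace K p τ) x

/-- **`φ_τ` maps `𝒪_{v(τ)}` into `ℤ̄_p`**: `|y|_{v(τ)} ≤ 1 ⇒ |φ_τ y| ≤ 1`.  Proof: the set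
`{y : |φ_τ y| ≤ 1}` is closed (`φ_τ` continuous); if some `y ∈ 𝒪_v` were outside it, the non-empty
open set `𝒪_v ∖ {…}` would contain some `x ∈ K` (density), with `v(x) ≥ 0` but `|τ x| > 1`,
contradicting `valued_le_one_iff`. [cite: NeukirchANT1999, Ch. II §8 (p. 161) with (8.1)] -/
theorem valued_padicPlaceHom_le_one (τ : K →+* PadicAlgCl p)
    {y : (padicPlace K p τ).adicCompletion K} (hy : Valued.v y ≤ 1) :
    Valued.v (padicPlaceHom K p τ y) ≤ 1 := by
  have hiff : ∀ w : PadicAlgCl p, Valued.v w ≤ 1 ↔ ‖w‖ ≤ 1 := fun w => by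
    rw [PadicAlgCl.valuation_def, ← NNReal.coe_le_coe, coe_nnnorm, NNReal.coe_one]
  rw [hiff]
  by_contra hyC
  -- `{z : ‖φ_τ z‖ ≤ 1}` is closed, `𝒪_v` is open
  have hCc : IsClosed {z : (padicPlace K p τ).adicCompletion K | ‖padicPlaceHom K p τ z‖ ≤ 1} :=
    isClosed_le (continuous_norm.comp (continuous_padicPlaceHom K p τ)) continuous_const
  have hO : IsOpen ((((padicPlace K p τ).adicCompletionIntegers K :
      Set ((padicPlace K p τ).adicCompletion K))) ∩
        {z : (padicPlace K p τ).adicCompletion K | ‖padicPlaceHom K p τ z‖ ≤ 1}ᶜ) :=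
    (Valued.isOpen_valuationSubring _).inter hCc.isOpen_compl
  -- so `𝒪_v ∖ {…}` contains some `x ∈ K`: `v(x) ≥ 0` but `|τ x| > 1`
  obtain ⟨x, hxO, hxC⟩ :=
    (HeightOneSpectrum.denseRange_algebraMap K (padicPlace K p τ)).exists_mem_open hO
      ⟨y, (HeightOneSpectrum.mem_adicCompletionIntegers (𝓞 K) K _).2 hy, hyC⟩
  apply hxC
  show ‖padicPlaceHom K p τ (algebraMap K _ x)‖ ≤ 1
  rw [← hiff, padicPlaceHom_algebraMap, valued_le_one_iff,
    ← HeightOneSpectrum.valuedAdicCompletion_eq_valuation']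
  exact (HeightOneSpectrum.mem_adicCompletionIntegers (𝓞 K) K _).1 hxO

/-! ### All `φ_τ(K_{v(τ)})` lie in one finite extension of `ℚ_p` -/

/-- `φ_τ(K_{v(τ)})` lies in every closed subset of `ℚ̄_p` containing `τ(K)` (density of `K` in
`K_v`, continuity of `φ_τ`). [cite: NeukirchANT1999, Ch. II §8 (p. 161)] -/
theorem padicPlaceHom_mem_of_forall_mem (τ : K →+* PadicAlgCl p) {S : Set (PadicAlgCl p)}
    (hS : IsClosed S) (hτ : ∀ x : K, τ x ∈ S) (y : (padicPlace K p τ).adicCompletion K) :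
    padicPlaceHom K p τ y ∈ S := by
  refine (HeightOneSpectrum.denseRange_algebraMap K (padicPlace K p τ)).induction_on
    (p := fun z => padicPlaceHom K p τ z ∈ S) y (hS.preimage (continuous_padicPlaceHom K p τ)) ?_
  intro x
  rw [padicPlaceHom_algebraMap]
  exact hτ x

/-- A finite-dimensional intermediate field of `ℚ̄_p / ℚ_p` is closed in `ℚ̄_p`. [folklore] -/
theorem isClosed_intermediateField (L : IntermediateField ℚ_[p] (PadicAlgCl p))
    [FiniteDimensional ℚ_[p] L] : IsClosed (L : Set (PadicAlgCl p)) := by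
  have h : IsClosed ((L.toSubalgebra.toSubmodule : Submodule ℚ_[p] (PadicAlgCl p)) :
      Set (PadicAlgCl p)) := by
    haveI : FiniteDimensional ℚ_[p] (L.toSubalgebra.toSubmodule : Submodule ℚ_[p] (PadicAlgCl p)) :=
      inferInstanceAs (FiniteDimensional ℚ_[p] L)
    exact Submodule.closed_of_finiteDimensional _
  exact h

/-- **There is a finite extension `E/ℚ_p` inside `ℚ̄_p` containing every `φ_τ(K_{v(τ)})`**: the
compositum over the (finitely many) `τ` of finite extensions `L_τ ⊇ τ(K)`
(`exists_intermediateField_finiteDimensional_range_subset`), each closed.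
[cite: NeukirchANT1999, Ch. II §8 (p. 161: "the finite complete extension τL·K_v of K_v")] -/
theorem exists_intermediateField_forall_padicPlaceHom_mem :
    ∃ E : IntermediateField ℚ_[p] (PadicAlgCl p), FiniteDimensional ℚ_[p] E ∧
      ∀ (τ : K →+* PadicAlgCl p) (y : (padicPlace K p τ).adicCompletion K),
        padicPlaceHom K p τ y ∈ E := by
  choose L hLfd hLτ using fun τ : K →+* PadicAlgCl p =>
    Literature.NumberTheory.EllipticCurves.exists_intermediateField_finiteDimensional_range_subset τ
  haveI := hLfd
  refine ⟨⨆ τ, L τ, IntermediateField.finiteDimensional_iSup_of_finite, fun τ y => ?_⟩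
  exact (le_iSup L τ : L τ ≤ ⨆ τ, L τ)
    (padicPlaceHom_mem_of_forall_mem K p τ (isClosed_intermediateField p (L τ)) (hLτ τ) y)

/-! ### The coefficient field `E` and its ring of integers `𝒪_E` -/

/-- **A finite extension `E/ℚ_p` inside `ℚ̄_p` containing every `φ_τ(K_{v(τ)})`** (a choice).
[cite: NeukirchANT1999, Ch. II §8 (p. 161)] -/
def coeffField : IntermediateField ℚ_[p] (PadicAlgCl p) :=
  (exists_intermediateField_forall_padicPlaceHom_mem K p).choose

/-- `E` is finite over `ℚ_p`. [folklore] -/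
theorem finiteDimensional_coeffField : FiniteDimensional ℚ_[p] (coeffField K p) :=
  (exists_intermediateField_forall_padicPlaceHom_mem K p).choose_spec.1

/-- Every `φ_τ` takes values in `E`. [folklore] -/
theorem padicPlaceHom_mem_coeffField (τ : K →+* PadicAlgCl p)
    (y : (padicPlace K p τ).adicCompletion K) : padicPlaceHom K p τ y ∈ coeffField K p :=
  (exists_intermediateField_forall_padicPlaceHom_mem K p).choose_spec.2 τ y

/-- In particular every `τ : K → ℚ̄_p` takes values in `E`. [folklore] -/
theorem apply_mem_coeffField (τ : K →+* PadicAlgCl p) (x : K) : τ x ∈ coeffField K p := by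
  rw [← padicPlaceHom_algebraMap K p τ x]
  exact padicPlaceHom_mem_coeffField K p τ _

/-- **The coefficient ring `𝒪_E = {x ∈ E : |x| ≤ 1}`**, the closed unit ball of `E`, as a subring of
`ℚ̄_p` (the intersection of `E` with the valuation ring `ℤ̄_p`). [folklore] -/
def coeffRing : Subring (PadicAlgCl p) :=
  (coeffField K p).toSubring ⊓
    (Valued.v : Valuation (PadicAlgCl p) NNReal).valuationSubring.toSubring

/-- Membership in `𝒪_E`. [folklore] -/
theorem mem_coeffRing_iff {x : PadicAlgCl p} :
    x ∈ coeffRing K p ↔ x ∈ coeffField K p ∧ Valued.v x ≤ 1 := by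
  rw [coeffRing, Subring.mem_inf]
  exact Iff.rfl

/-- `𝒪_E ⊆ ℤ̄_p`: elements of `𝒪_E` have `|x| ≤ 1`. [folklore] -/
theorem valued_le_one_of_mem_coeffRing {x : PadicAlgCl p} (hx : x ∈ coeffRing K p) : Valued.v x ≤ 1 :=
  ((mem_coeffRing_iff K p).1 hx).2

/-- `𝒪_E ⊆ E`. [folklore] -/
theorem mem_coeffField_of_mem_coeffRing {x : PadicAlgCl p} (hx : x ∈ coeffRing K p) :
    x ∈ coeffField K p :=
  ((mem_coeffRing_iff K p).1 hx).1

/-- **`φ_τ(𝒪_{v(τ)}) ⊆ 𝒪_E`** — the hypothesis `h𝒪` of `TameLevelCoeffLattice` for `𝒪 = 𝒪_E`.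
[cite: NeukirchANT1999, Ch. II §8 (p. 161) with (8.1)] -/
theorem padicPlaceHom_mem_coeffRing (τ : K →+* PadicAlgCl p)
    (y : (padicPlace K p τ).adicCompletion K) (hy : Valued.v y ≤ 1) :
    padicPlaceHom K p τ y ∈ coeffRing K p :=
  (mem_coeffRing_iff K p).2 ⟨padicPlaceHom_mem_coeffField K p τ y, valued_padicPlaceHom_le_one K p τ hy⟩

/-- `p` is not a unit of `𝒪_E` (`|p| < 1`), so that the ideals `p^s 𝒪_E` are proper. [folklore] -/
theorem not_isUnit_natCast_prime : ¬ IsUnit (((p : ℕ) : coeffRing K p)) := by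
  rintro ⟨u, hu⟩
  have h1 : Valued.v ((u : coeffRing K p) : PadicAlgCl p) * Valued.v ((↑(u⁻¹) : coeffRing K p) : PadicAlgCl p) = 1 := by
    rw [← map_mul, ← Subring.coe_mul, Units.mul_inv, Subring.coe_one, map_one]
  have hp : (p : ℕ).Prime := Fact.out
  have h2 : Valued.v ((u : coeffRing K p) : PadicAlgCl p) < 1 := by
    rw [hu, Subring.coe_natCast, PadicAlgCl.valuation_p, one_div]
    exact inv_lt_one_of_one_lt₀ (by exact_mod_cast hp.one_lt)
  have h3 : Valued.v ((↑(u⁻¹) : coeffRing K p) : PadicAlgCl p) ≤ 1 :=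
    valued_le_one_of_mem_coeffRing K p (↑(u⁻¹) : coeffRing K p).2
  have : Valued.v ((u : coeffRing K p) : PadicAlgCl p) *
      Valued.v ((↑(u⁻¹) : coeffRing K p) : PadicAlgCl p) < 1 :=
    mul_lt_one_of_nonneg_of_lt_one_left zero_le h2 h3
  exact absurd h1 this.ne

end Literature.NumberTheory.Automorphic.ParallelWeight
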